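import Mathlib
import Literature.Analysis.FluidPDE.TypeIICoreWitness
import Literature.Analysis.FluidPDE.SuitableWeak
import Summits.NavierStokesRegularity.NavierStokesRegularity.Theorems.TypeIIInviscidRelaxationCoreExclusionAnchorObstruction
import HarnessLib

/-!
# Cruxes `ColumnarCoreExclusion` (stmt-1966) / `MonopoleCoreExclusion` (stmt-1965): a CORE-RADIUS FLOOR does not
# force LATENESS — the fourth corner of the independence square, at exactly the Euler rate

`--supports stmt-NavierStokesRegularity-1966` (helper file, negative side; theorems only, no definitions, no `sorry`;
outside the import cone of the route file).

The residual of the registered anchor stubs `stub_anchoredLateColumnarWitness` (1966) / `stub_anchoredLateAxisymWitness`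
(1965) beyond the crux hypothesis `hw` is «LATENESS `(T-t)V ≤ KL` ∧ CORE-RADIUS FLOOR `r₀ ≤ KL`»
(`CoreExclusionAnchor.anchoredLateWitness_of_lateWitnesses_radiusFloor`, p831087).  Kernel certificates so far:
neither follows from `hw` (`CoreExclusionAnchorObstruction.exists_columnarWitnesses_never_late`: no floor, never late,
super-Euler speed `(1-t)⁻³`); late ⇏ floor (`…AnchorObstructionLate`, intermediate rates); at an Euler-rate FLOOR
late ⇒ floor (`…AnchorReductionEulerRate`); below the Euler rate floor ⇒ late (`…AnchorReductionSubEulerRate`,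
p836345).  THIS FILE closes the square: FLOOR ⇏ LATE, by an explicit kinematic family sitting EXACTLY at the Euler
rate `(1-t)‖u(t)‖∞ = 1` — so the sub-Euler hypothesis `(T-t)‖u(t)‖∞ → 0` of p836345 cannot be relaxed to an Euler-rate
bound, and the Euler-rate hypothesis of `…AnchorReductionEulerRate` does not by itself turn floor witnesses into late
ones.

* `CoreExclusionAnchorObstructionFloor.exists_floorColumnarWitnesses_never_late` — the family `u : ℝ → ℝ³ → ℝ³`, at
  time `t < 1` with `s = 1 - t`: the columnar cone core `s⁻¹ · max(0, 1 - r(x)/s) e_z` cut off outside the FIXED ball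
  `‖x‖ ≤ 1/3` (NOT a Navier–Stokes solution).  (i) At every level `K > 0`, after every `t₀ < 1`, it carries a
  level-`K` COLUMNAR witness at viscosity `1` WITH CORE RADIUS `K·L = 1/3` (the hypothesis `hwfloor` of p836345 with
  `r₀ = 1/3`; centre `0`, `L = (3K)⁻¹`, `V = s⁻¹`, `Q = id`, profile the dilated cone `y ↦ G((3K s)⁻¹ y)`, closeness
  error `0`); in particular `hw` holds; (ii) it is not Type I (`‖u(t,0)‖ = (1-t)⁻¹`); (iii) it has EXACTLY the Euler
  rate: `(1-t)‖u(t,x)‖ ≤ 1` everywhere and `(1-t)‖u(t,0)‖ = 1`; (iv) for every `K > 4` and every `0 < t < 1`, EVERY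
  datum satisfying the speed-bound, near-maximum and level-`K` columnar-closeness clauses has `K·L < 1 ≤ (1-t)·V` —
  NO such witness is late; (v) hence "late level-`5` columnar witnesses frequently" fails although floor witnesses
  exist at every level.

Reading (honest framing): lateness and the floor are logically independent given `hw` and any rate bookkeeping; all
four corners are now kernel-certified.  Nothing about Navier–Stokes regularity is claimed; no stub or crux is proved
or refuted (the family is not a Navier–Stokes solution, and the stubs' hypotheses include a genuine blow-up).
-/

noncomputable section

open Set Metric Filter Topology
open Literature.Analysis Literature.Analysis.FluidPDE

namespace Summit.NavierStokesRegularity.NavierStokesRegularity.Theorems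

-- the problem directory repeats the summit name (`NavierStokesRegularity/NavierStokesRegularity`)
set_option linter.dupNamespace false

namespace CoreExclusionAnchorObstructionFloor

open CoreExclusionAnchorObstruction

/-- `‖e_z‖ = 1` (file-local copy). [folklore] -/
private theorem norm_eZ : ‖(eZ : EuclideanSpace ℝ (Fin 3))‖ = 1 := by
  simp [eZ]

/-- The cone profile vanishes at `c • e_x` for `c ≥ 1` (cylindrical radius `c`). [folklore] -/
theorem coneProfile_smul_single_zero {c : ℝ} (hc : 1 ≤ c) :
    max 0 (1 - cylRadius (c • EuclideanSpace.single (0 : Fin 3) (1 : ℝ))) • (eZ : EuclideanSpace ℝ (Fin 3)) = 0 := by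
  have h1 : cylRadius (EuclideanSpace.single (0 : Fin 3) (1 : ℝ)) = 1 := by
    simp [cylRadius]
  rw [cylRadius_smul, h1, mul_one, abs_of_pos (by linarith), max_eq_left (by linarith), zero_smul]

/-- The dilated cone profile `y ↦ G(c • y)` is columnar. [folklore] -/
theorem isColumnar_coneProfile_dilate (c : ℝ) :
    IsColumnar (fun y : EuclideanSpace ℝ (Fin 3) =>
      max 0 (1 - cylRadius (c • y)) • (eZ : EuclideanSpace ℝ (Fin 3))) := by
  have h := (isColumnar_coneProfile).rescale 0 c
  simpa only [zero_add] using h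

/-- **A core-radius floor does not force lateness** (kinematic certificate at exactly the Euler rate).  There is an
explicit family `u : ℝ → ℝ³ → ℝ³` — at time `t < 1`, with `s = 1 - t`: the columnar cone core
`s⁻¹ · max(0, 1 - r(x)/s) e_z` cut off outside the fixed ball `‖x‖ ≤ 1/3` (NOT a Navier–Stokes solution) — such that
(i) at viscosity `1`, at every level `K > 0`, after every `t₀ < 1`, `u` carries a level-`K` COLUMNAR witness with core
radius `K·L ≥ 1/3` (a FLOOR); (ii) `¬ IsTypeIBlowup u 1`; (iii) `u` has exactly the Euler rate:
`(1-t)‖u(t,x)‖ ≤ 1` for all `x` and `(1-t)‖u(t,0)‖ = 1`, `t < 1`; (iv) for every `K > 4` and every `0 < t < 1`,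
every datum `(x₀, L, V, Q, W)` satisfying the speed-bound, near-maximum and level-`K` columnar-closeness clauses has
`K·L < 1` and `1 ≤ (1-t)·V`, so it is NOT late; (v) the "late level-`5` columnar witnesses frequently" statement
fails.  Fourth corner of the independence square «lateness / floor» for the anchor stubs of cruxes
`ColumnarCoreExclusion` / `MonopoleCoreExclusion`; shows the sub-Euler hypothesis of
`CoreExclusionAnchor.anchoredLateWitness_of_floorWitnesses_subEulerRate` cannot be relaxed to an Euler-rate bound.
[folklore] -/
theorem exists_floorColumnarWitnesses_never_late :
    ∃ u : ℝ → EuclideanSpace ℝ (Fin 3) → EuclideanSpace ℝ (Fin 3),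
      (∃ r₀ : ℝ, 0 < r₀ ∧ ∀ K : ℝ, 0 < K → ∀ t₀ < (1 : ℝ), ∃ t, t₀ < t ∧ t < 1 ∧
        ∃ (x₀ : EuclideanSpace ℝ (Fin 3)) (L V : ℝ)
          (Q : EuclideanSpace ℝ (Fin 3) ≃ₗᵢ[ℝ] EuclideanSpace ℝ (Fin 3))
          (W : EuclideanSpace ℝ (Fin 3) → EuclideanSpace ℝ (Fin 3)),
          0 < L ∧ 0 < V ∧ IsColumnar W ∧ (∀ x, ‖u t x‖ ≤ V) ∧
          (∃ x₁, dist x₁ x₀ ≤ L ∧ V ≤ 2 * ‖u t x₁‖) ∧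
          (∃ y y' : EuclideanSpace ℝ (Fin 3), ‖y‖ ≤ 1 ∧ ‖y'‖ ≤ 1 ∧ (4 : ℝ)⁻¹ ≤ ‖W y - W y'‖) ∧
          K * 1 ≤ L * V ∧
          (∀ y : EuclideanSpace ℝ (Fin 3), ‖y‖ ≤ K →
            ‖V⁻¹ • Q.symm (u t (x₀ + L • Q y)) - W y‖ ≤ K⁻¹) ∧
          r₀ ≤ K * L) ∧
      (∀ K : ℝ, 0 < K → ∀ t₀ < (1 : ℝ), ∃ t, t₀ < t ∧ t < 1 ∧ TypeIICoreWitness IsColumnar 1 K u t) ∧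
      ¬ IsTypeIBlowup u 1 ∧
      ((∀ t < (1 : ℝ), ∀ x, (1 - t) * ‖u t x‖ ≤ 1) ∧ (∀ t < (1 : ℝ), (1 - t) * ‖u t 0‖ = 1)) ∧
      (∀ (K t : ℝ), 4 < K → 0 < t → t < 1 →
        ∀ (x₀ : EuclideanSpace ℝ (Fin 3)) (L V : ℝ)
          (Q : EuclideanSpace ℝ (Fin 3) ≃ₗᵢ[ℝ] EuclideanSpace ℝ (Fin 3))
          (W : EuclideanSpace ℝ (Fin 3) → EuclideanSpace ℝ (Fin 3)),
          0 < L → 0 < V → IsColumnar W → (∀ x, ‖u t x‖ ≤ V) →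
          (∃ x₁, dist x₁ x₀ ≤ L ∧ V ≤ 2 * ‖u t x₁‖) →
          (∀ y : EuclideanSpace ℝ (Fin 3), ‖y‖ ≤ K →
            ‖V⁻¹ • Q.symm (u t (x₀ + L • Q y)) - W y‖ ≤ K⁻¹) →
          K * L < 1 ∧ 1 ≤ (1 - t) * V ∧ ¬ ((1 - t) * V ≤ K * L)) ∧
      ¬ (∀ t₀ < (1 : ℝ), ∃ t, t₀ < t ∧ t < 1 ∧
        ∃ (x₀ : EuclideanSpace ℝ (Fin 3)) (L V : ℝ)
          (Q : EuclideanSpace ℝ (Fin 3) ≃ₗᵢ[ℝ] EuclideanSpace ℝ (Fin 3))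
          (W : EuclideanSpace ℝ (Fin 3) → EuclideanSpace ℝ (Fin 3)),
          0 < L ∧ 0 < V ∧ IsColumnar W ∧ (∀ x, ‖u t x‖ ≤ V) ∧
          (∃ x₁, dist x₁ x₀ ≤ L ∧ V ≤ 2 * ‖u t x₁‖) ∧
          (∃ y y' : EuclideanSpace ℝ (Fin 3), ‖y‖ ≤ 1 ∧ ‖y'‖ ≤ 1 ∧ (4 : ℝ)⁻¹ ≤ ‖W y - W y'‖) ∧
          5 * (1 : ℝ) ≤ L * V ∧
          (∀ y : EuclideanSpace ℝ (Fin 3), ‖y‖ ≤ 5 →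
            ‖V⁻¹ • Q.symm (u t (x₀ + L • Q y)) - W y‖ ≤ (5 : ℝ)⁻¹) ∧
          (1 - t) * V ≤ 5 * L) := by
  -- the profile and the family
  set G : EuclideanSpace ℝ (Fin 3) → EuclideanSpace ℝ (Fin 3) :=
    fun y => max 0 (1 - cylRadius y) • (eZ : EuclideanSpace ℝ (Fin 3)) with hG
  set u : ℝ → EuclideanSpace ℝ (Fin 3) → EuclideanSpace ℝ (Fin 3) :=
    fun t x => if ‖x‖ ≤ 3⁻¹ then (1 - t)⁻¹ • G ((1 - t)⁻¹ • x) else 0 with hu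
  have hGle : ∀ y, ‖G y‖ ≤ 1 := fun y => norm_coneProfile_le y
  have hG0 : G 0 = eZ := coneProfile_zero
  -- value at the origin and the global speed bound
  have hu0 : ∀ t < (1 : ℝ), u t 0 = (1 - t)⁻¹ • (eZ : EuclideanSpace ℝ (Fin 3)) := by
    intro t ht
    have h : ‖(0 : EuclideanSpace ℝ (Fin 3))‖ ≤ 3⁻¹ := by rw [norm_zero]; positivity
    simp only [hu, if_pos h, smul_zero, hG0]
  have hnorm0 : ∀ t < (1 : ℝ), ‖u t 0‖ = (1 - t)⁻¹ := by
    intro t ht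
    have hs : 0 < 1 - t := sub_pos.2 ht
    rw [hu0 t ht, norm_smul, norm_eZ, mul_one, Real.norm_of_nonneg (inv_nonneg.2 hs.le)]
  have hbound : ∀ t < (1 : ℝ), ∀ x, ‖u t x‖ ≤ (1 - t)⁻¹ := by
    intro t ht x
    have hs : 0 < 1 - t := sub_pos.2 ht
    by_cases hx : ‖x‖ ≤ 3⁻¹
    · simp only [hu, if_pos hx]
      rw [norm_smul, Real.norm_of_nonneg (inv_nonneg.2 hs.le)]
      exact mul_le_of_le_one_right (inv_nonneg.2 hs.le) (hGle _)
    · simp only [hu, if_neg hx, norm_zero]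
      positivity
  have hsupp : ∀ t x, u t x ≠ 0 → dist x (0 : EuclideanSpace ℝ (Fin 3)) ≤ 3⁻¹ := by
    intro t x hx
    rw [dist_zero_right]
    by_contra h
    exact hx (by simp only [hu, if_neg h])
  -- the slice on the ball `‖x‖ ≤ 1/3`, read through a core length `L` with `K L = 1/3`
  have hcore : ∀ t < (1 : ℝ), ∀ (K : ℝ), 0 < K → ∀ y : EuclideanSpace ℝ (Fin 3), ‖y‖ ≤ K →
      u t ((0 : EuclideanSpace ℝ (Fin 3)) + (3 * K)⁻¹ • (LinearIsometryEquiv.refl ℝ _ y)) =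
        (1 - t)⁻¹ • G (((1 - t)⁻¹ * (3 * K)⁻¹) • y) := by
    intro t ht K hK y hy
    have hK3 : 0 < (3 * K)⁻¹ := by positivity
    have hn : ‖(3 * K)⁻¹ • y‖ ≤ 3⁻¹ := by
      rw [norm_smul, Real.norm_of_nonneg hK3.le]
      calc (3 * K)⁻¹ * ‖y‖ ≤ (3 * K)⁻¹ * K := mul_le_mul_of_nonneg_left hy hK3.le
        _ = 3⁻¹ := by field_simp
    simp only [LinearIsometryEquiv.coe_refl, id_eq, zero_add]
    simp only [hu, if_pos hn, smul_smul]
  -- never late: every admissible datum has `K L < 1 ≤ (1 - t) V`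
  have hnever : ∀ (K t : ℝ), 4 < K → 0 < t → t < 1 →
      ∀ (x₀ : EuclideanSpace ℝ (Fin 3)) (L V : ℝ)
        (Q : EuclideanSpace ℝ (Fin 3) ≃ₗᵢ[ℝ] EuclideanSpace ℝ (Fin 3))
        (W : EuclideanSpace ℝ (Fin 3) → EuclideanSpace ℝ (Fin 3)),
        0 < L → 0 < V → IsColumnar W → (∀ x, ‖u t x‖ ≤ V) →
        (∃ x₁, dist x₁ x₀ ≤ L ∧ V ≤ 2 * ‖u t x₁‖) →
        (∀ y : EuclideanSpace ℝ (Fin 3), ‖y‖ ≤ K →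
          ‖V⁻¹ • Q.symm (u t (x₀ + L • Q y)) - W y‖ ≤ K⁻¹) →
        K * L < 1 ∧ 1 ≤ (1 - t) * V := by
    intro K t hK ht0 ht1 x₀ L V Q W hL hV hW hbd hnear hclose
    have hs : 0 < 1 - t := sub_pos.2 ht1
    have hKL : K * L < 3 * (3⁻¹ : ℝ) :=
      coreRadius_lt_of_support (hsupp t) hK hL hV hW hnear hclose
    have hV' : (1 - t)⁻¹ ≤ V := by rw [← hnorm0 t ht1]; exact hbd 0
    refine ⟨by norm_num at hKL; exact hKL, ?_⟩
    have h1 : (1 - t) * (1 - t)⁻¹ ≤ (1 - t) * V := mul_le_mul_of_nonneg_left hV' hs.le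
    rwa [mul_inv_cancel₀ hs.ne'] at h1
  -- (i) floor witnesses (`K L = 1/3`) at every level frequently before `1`
  have hfloorW : ∀ K : ℝ, 0 < K → ∀ t₀ < (1 : ℝ), ∃ t, t₀ < t ∧ t < 1 ∧
      ∃ (x₀ : EuclideanSpace ℝ (Fin 3)) (L V : ℝ)
          (Q : EuclideanSpace ℝ (Fin 3) ≃ₗᵢ[ℝ] EuclideanSpace ℝ (Fin 3))
          (W : EuclideanSpace ℝ (Fin 3) → EuclideanSpace ℝ (Fin 3)),
          0 < L ∧ 0 < V ∧ IsColumnar W ∧ (∀ x, ‖u t x‖ ≤ V) ∧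
          (∃ x₁, dist x₁ x₀ ≤ L ∧ V ≤ 2 * ‖u t x₁‖) ∧
          (∃ y y' : EuclideanSpace ℝ (Fin 3), ‖y‖ ≤ 1 ∧ ‖y'‖ ≤ 1 ∧ (4 : ℝ)⁻¹ ≤ ‖W y - W y'‖) ∧
          K * 1 ≤ L * V ∧
          (∀ y : EuclideanSpace ℝ (Fin 3), ‖y‖ ≤ K →
            ‖V⁻¹ • Q.symm (u t (x₀ + L • Q y)) - W y‖ ≤ K⁻¹) ∧
          3⁻¹ ≤ K * L := by
    intro K hK t₀ ht₀
    set m : ℝ := min (6 * K)⁻¹ (6 * K ^ 2)⁻¹ with hm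
    have hm0 : 0 < m := lt_min (by positivity) (by positivity)
    set t : ℝ := (max t₀ (1 - m) + 1) / 2 with ht
    have hmax_lt : max t₀ (1 - m) < 1 := max_lt ht₀ (by linarith)
    have ht₀t : t₀ < t := by
      have := le_max_left t₀ (1 - m); rw [ht]; linarith
    have ht1 : t < 1 := by rw [ht]; linarith
    have hs : 0 < 1 - t := sub_pos.2 ht1
    have hsm : 1 - t ≤ m := by
      have := le_max_right t₀ (1 - m); rw [ht]; linarith
    have hsK : 1 - t ≤ (6 * K)⁻¹ := hsm.trans (min_le_left _ _)
    have hsK2 : 1 - t ≤ (6 * K ^ 2)⁻¹ := hsm.trans (min_le_right _ _)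
    have hL : 0 < (3 * K)⁻¹ := by positivity
    -- the dilation factor `c = (1-t)⁻¹ (3K)⁻¹ ≥ 2`
    set c : ℝ := (1 - t)⁻¹ * (3 * K)⁻¹ with hc
    have hc1 : 1 ≤ c := by
      rw [hc]
      have h6 : (6 * K)⁻¹ ≤ (3 * K)⁻¹ := by
        apply inv_anti₀ (by positivity); linarith
      have h7 : 1 - t ≤ (3 * K)⁻¹ := hsK.trans h6
      calc (1 : ℝ) = (1 - t)⁻¹ * (1 - t) := (inv_mul_cancel₀ hs.ne').symm
        _ ≤ (1 - t)⁻¹ * (3 * K)⁻¹ := mul_le_mul_of_nonneg_left h7 (inv_nonneg.2 hs.le)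
    refine ⟨t, ht₀t, ht1, 0, (3 * K)⁻¹, (1 - t)⁻¹, LinearIsometryEquiv.refl ℝ _,
      fun y => G (c • y), hL, inv_pos.2 hs, ?_, hbound t ht1, ?_, ?_, ?_, ?_, ?_⟩
    · -- columnar
      exact isColumnar_coneProfile_dilate c
    · -- near-maximum at the origin
      refine ⟨0, by rw [dist_self]; exact hL.le, ?_⟩
      rw [hnorm0 t ht1]; linarith [inv_pos.2 hs]
    · -- oscillation: `G 0 = e_z`, `G (c e_x) = 0`
      refine ⟨0, EuclideanSpace.single 0 1, by simp, by simp, ?_⟩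
      have hG1 : G (c • EuclideanSpace.single 0 1) = 0 := coneProfile_smul_single_zero hc1
      show (4 : ℝ)⁻¹ ≤ ‖G (c • (0 : EuclideanSpace ℝ (Fin 3))) - G (c • EuclideanSpace.single 0 1)‖
      rw [smul_zero, hG0, hG1, sub_zero, norm_eZ]
      norm_num
    · -- Reynolds: `K ≤ (3K)⁻¹ (1-t)⁻¹`
      rw [mul_one, le_mul_inv_iff₀ hs]
      calc K * (1 - t) ≤ K * (6 * K ^ 2)⁻¹ := mul_le_mul_of_nonneg_left hsK2 hK.le
        _ = (6 * K)⁻¹ := by field_simp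
        _ ≤ (3 * K)⁻¹ := by apply inv_anti₀ (by positivity); linarith
    · -- closeness with error `0`
      intro y hy
      have hrefl : ∀ z : EuclideanSpace ℝ (Fin 3),
          (LinearIsometryEquiv.refl ℝ (EuclideanSpace ℝ (Fin 3))).symm z = z := fun z => rfl
      rw [hcore t ht1 K hK y hy, hrefl, smul_smul, inv_mul_cancel₀ (inv_pos.2 hs).ne', one_smul]
      show ‖G (((1 - t)⁻¹ * (3 * K)⁻¹) • y) - G (c • y)‖ ≤ K⁻¹
      rw [← hc, sub_self, norm_zero]
      positivity
    · -- the floor `1/3 ≤ K L`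
      have : K * (3 * K)⁻¹ = 3⁻¹ := by field_simp
      rw [this]
  refine ⟨u, ⟨3⁻¹, by norm_num, hfloorW⟩, ?_, ?_, ⟨?_, ?_⟩, ?_, ?_⟩
  · -- (i') in particular the crux hypothesis `hw` (drop the floor clause)
    intro K hK t₀ ht₀
    obtain ⟨t, ht₀t, ht1, x₀, L, V, Q, W, hL, hV, hW, hbd, hnear, hosc, hRe, hclose, -⟩ := hfloorW K hK t₀ ht₀
    exact ⟨t, ht₀t, ht1, x₀, L, V, Q, W, hL, hV, hW, hbd, hnear, hosc, hRe, hclose⟩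
  · -- (ii) not Type I at the origin: `‖u(1-s,0)‖ = s⁻¹ ≤ C/√s` fails for `s ≤ (|C|+2)⁻²`
    rintro ⟨C, hC⟩
    obtain ⟨l, hl1, hsub⟩ := mem_nhdsLT_iff_exists_Ioo_subset.1 hC
    rw [mem_Iio] at hl1
    have hC2 : 0 < |C| + 2 := by positivity
    set s : ℝ := min ((1 - l) / 2) ((|C| + 2) ^ 2)⁻¹ with hsdef
    have hs0 : 0 < s := lt_min (by linarith) (by positivity)
    have hsl : s ≤ (1 - l) / 2 := min_le_left _ _
    have hsC : s ≤ ((|C| + 2) ^ 2)⁻¹ := min_le_right _ _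
    have hmem : 1 - s ∈ Ioo l 1 := ⟨by linarith, by linarith⟩
    have h : ‖u (1 - s) 0‖ ≤ C / Real.sqrt (1 - (1 - s)) := hsub hmem 0
    rw [hnorm0 (1 - s) (by linarith)] at h
    simp only [sub_sub_cancel] at h
    have hsqrt : 0 < Real.sqrt s := Real.sqrt_pos.2 hs0
    have h2 : s⁻¹ * Real.sqrt s ≤ C := by
      have := mul_le_mul_of_nonneg_right h hsqrt.le
      rwa [div_mul_cancel₀ _ hsqrt.ne'] at this
    have hss : Real.sqrt s * Real.sqrt s = s := Real.mul_self_sqrt hs0.le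
    have h5 : (1 : ℝ) ≤ C * Real.sqrt s := by
      have h6 := mul_le_mul_of_nonneg_right h2 hsqrt.le
      calc (1 : ℝ) = s⁻¹ * (Real.sqrt s * Real.sqrt s) := by rw [hss, inv_mul_cancel₀ hs0.ne']
        _ = s⁻¹ * Real.sqrt s * Real.sqrt s := by ring
        _ ≤ C * Real.sqrt s := h6
    have hsq : Real.sqrt s ≤ (|C| + 2)⁻¹ := by
      calc Real.sqrt s ≤ Real.sqrt (((|C| + 2) ^ 2)⁻¹) := Real.sqrt_le_sqrt hsC
        _ = (|C| + 2)⁻¹ := by rw [Real.sqrt_inv, Real.sqrt_sq hC2.le]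
    have h7 : C * Real.sqrt s ≤ |C| * (|C| + 2)⁻¹ :=
      calc C * Real.sqrt s ≤ |C| * Real.sqrt s := mul_le_mul_of_nonneg_right (le_abs_self C) hsqrt.le
        _ ≤ |C| * (|C| + 2)⁻¹ := mul_le_mul_of_nonneg_left hsq (abs_nonneg C)
    have h8 : |C| * (|C| + 2)⁻¹ < 1 := by
      rw [mul_inv_lt_iff₀ hC2]; linarith [abs_nonneg C]
    linarith
  · -- (iii a) Euler-rate ceiling everywhere
    intro t ht x
    have hs : 0 < 1 - t := sub_pos.2 ht
    have h1 : (1 - t) * ‖u t x‖ ≤ (1 - t) * (1 - t)⁻¹ := mul_le_mul_of_nonneg_left (hbound t ht x) hs.le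
    rwa [mul_inv_cancel₀ hs.ne'] at h1
  · -- (iii b) Euler rate attained at the origin
    intro t ht
    have hs : 0 < 1 - t := sub_pos.2 ht
    rw [hnorm0 t ht, mul_inv_cancel₀ hs.ne']
  · -- (iv) every level-`K` datum (`K > 4`) is not late
    intro K t hK ht0 ht1 x₀ L V Q W hL hV hW hbd hnear hclose
    obtain ⟨h1, h2⟩ := hnever K t hK ht0 ht1 x₀ L V Q W hL hV hW hbd hnear hclose
    exact ⟨h1, h2, fun h => by linarith⟩
  · -- (v) no late level-`5` witnesses at any time after `0`
    intro hlate
    obtain ⟨t, ht0, ht1, x₀, L, V, Q, W, hL, hV, hW, hbd, hnear, -, -, hclose, hl⟩ := hlate 0 one_pos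
    obtain ⟨h1, h2⟩ := hnever 5 t (by norm_num) ht0 ht1 x₀ L V Q W hL hV hW hbd hnear hclose
    linarith

end CoreExclusionAnchorObstructionFloor

end Summit.NavierStokesRegularity.NavierStokesRegularity.Theorems

end
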